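import Summits.KontsevichZagierPeriods.Zeta5Search.Barrier.ConeGammaLogLipschitzCovering

/-!
# ζ(5) search — BARRIER: `Φ` IS LOCALLY LOG-LIPSCHITZ ON THE BOX — any two directions, rational or not

HONEST FRAMING (cell `pub-zeta5`): systematic search; no irrationality claim unless kernel-certified. MODEL objects
under Brown–Zudilin's (28)+(30) accounting ([BZ22] = arXiv:2210.03391; (28) observed, not proved); nothing here is a
statement about `ζ(5)`, about `γ`, any `γ` of record or the cone's supremum (C2 = `BarrierC2` OPEN). A CONTINUITY
statement about the MODEL saving `Φ = phi30` with explicit absolute constants of the no-cancellation scale; it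
certifies nothing at any direction, is NOT a usable bound for clause (ii), and moves no number or sentence of record;
S-E / S-E′ stay CONJECTURED (their content is the size of the constant at a rational centre); records in print
UNMOVED. Prover P2 g39, file (3) of the item «Φ is log-Lipschitz» (lead/lit g40 GO INBOX l.9789: «(3) only if it closes
in-seat»); files (1) `ConeGammaLogLipschitz`, (2) `ConeGammaLogLipschitzCovering`.

THE POINT. Files (1)–(2) give an explicit `x·log(1/x)` modulus of `Φ` around every RATIONAL direction on a ball of
radius `≍ 1/T`; every direction is within `1/(2T)` of the lattice `(1/T)ℤ⁸` and `T` is free, so `T = 1/(2D)` for two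
directions at sup-distance `D` gives a modulus between ANY two box directions — `Φ` is locally LOG-LIPSCHITZ:
* `abs_phiForm_le_of_single`, `shiftSize_le_of_single` — a displacement supported on ONE symmetric parameter has form
  size `≤` its size (every form involves two distinct parameters with coefficients `±1`);
* `abs_round_sub_round_le_one`, `round_div_nonneg` — rounding to the lattice `(1/T)ℤ`;
* `h28_aOfS_eq_add_phiForm`, **`abs_phi30_step`** — ONE LATTICE STEP: at a lattice point `r` of level `T` whose
  direction lies in the closed box with all forms `≥ 2/T`, every displacement of form size `≤ 1/T` that stays in the
  box moves `Φ` by at most `(28·log(T·x_max+1) + 203)/T` (file (2)'s `abs_phi30_sub_le_on_ball` at `ρ = 1/T`);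
* **`abs_phi30_sub_le_of_walk`** — THE EIGHT-STEP WALK: two lattice points `p, q` of level `T` with `|q_j − p_j| ≤ 1/T`
  whose coordinate hull (`s_j ∈ {p_j, q_j}`) consists of box directions with forms `≥ 2/T` and `x_max ≤ X`:
  `|Φ(aOfS q) − Φ(aOfS p)| ≤ 8·(28·log(T·X+1) + 203)/T` (one symmetric parameter at a time — a single-parameter step has
  form size `≤ 1/T`, inside the range `T·Y ≤ 1` of file (1), which a diagonal step would leave);
* **`abs_phi30_sub_le_of_norm_le`** — `Φ` IS LOCALLY LOG-LIPSCHITZ: for `a, a′` in the closed box with all 28 forms of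
  `a` at least `μ` and `‖s(a′) − s(a)‖ ≤ D` (sup norm), `0 < D ≤ μ/8`:
  **`|Φ(a′) − Φ(a)| ≤ D·(560·log(x_max(a)/(2D) + 3) + 4060)`** (round both to the level-`1/(2D)` lattice, one step
  each, and walk between the roundings in eight steps: ten steps of size `2D·(28·log(x_max(a)/(2D) + 3) + 203)`).
READING (structure, numbers not adjectives): with P2 g19's `phi30_diffQuot_tendsto_cuspSlope` (at a rational direction
with a non-zero cusp slope the one-sided difference quotient of `Φ` diverges like `log(1/ε)`) the local modulus of
continuity of the MODEL saving on the box is EXACTLY of the order `x·log(1/x)`: never worse (this file), no better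
wherever a cusp slope is non-zero (g19). The constants `560`, `4060` are absolute but of the no-cancellation scale — a
continuity theorem, NOT a certificate; nothing about `γ`, S-E's constant, C2 or `ζ(5)`.
-/

noncomputable section

open Set MeasureTheory
open scoped Topology

namespace Summit.KontsevichZagierPeriods.Zeta5Search.Barrier.ConeGamma

/-! ### Single-parameter displacements; lattice rounding -/

/-- If `η` is supported on the single coordinate `i`, then `|η a| + |η b| ≤ |η i|` for `a ≠ b`. -/
theorem abs_add_abs_le_of_single {η : Fin 8 → ℝ} {i : Fin 8} (h : ∀ j, j ≠ i → η j = 0) {a b : Fin 8}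
    (hab : a ≠ b) : |η a| + |η b| ≤ |η i| := by
  by_cases ha : a = i
  · subst ha
    rw [h b (Ne.symm hab), abs_zero, add_zero]
  · rw [h a ha, abs_zero, zero_add]
    by_cases hb : b = i
    · subst hb; exact le_rfl
    · rw [h b hb, abs_zero]; exact abs_nonneg _

/-- **A displacement supported on ONE symmetric parameter has every form bounded by its size**: if `η_j = 0` for
`j ≠ i` then `|φ_k(η)| ≤ |η_i|` for all 28 forms (each form is `±η_a ± η_b` with `a ≠ b`). -/
theorem abs_phiForm_le_of_single {η : Fin 8 → ℝ} {i : Fin 8} (h : ∀ j, j ≠ i → η j = 0) (k : Fin 28) :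
    |phiForm η k| ≤ |η i| := by
  rw [phiForm_eq]
  have hab := fstIdx_ne_sndIdx k
  generalize fstIdx k = a at hab
  generalize sndIdx k = b at hab
  unfold pairForm
  split_ifs with h0 h1
  · subst h0
    exact (abs_sub _ _).trans (abs_add_abs_le_of_single h hab)
  · subst h1
    exact (abs_sub _ _).trans (abs_add_abs_le_of_single h (Ne.symm hab))
  · exact (abs_add_le _ _).trans (abs_add_abs_le_of_single h hab)

/-- Hence its form size is at most its size: `Y(η) ≤ |η_i|`. -/
theorem shiftSize_le_of_single {η : Fin 8 → ℝ} {i : Fin 8} (h : ∀ j, j ≠ i → η j = 0) :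
    shiftSize η ≤ |η i| :=
  Finset.sup'_le _ _ fun k _ => abs_phiForm_le_of_single h k

/-- Rounding two numbers at distance `≤ 1/2` gives integers at distance `≤ 1`. -/
theorem abs_round_sub_round_le_one {x y : ℝ} (h : |x - y| ≤ 1 / 2) : |(round x : ℝ) - round y| ≤ 1 := by
  have hx := abs_sub_round x
  have hy := abs_sub_round y
  have h3 : |((round x - round y : ℤ) : ℝ)| < 2 := by
    push_cast
    have e : (round x : ℝ) - round y = (round x - x) + (x - y) + (y - round y) := by ring
    rw [e]
    refine lt_of_le_of_lt ((abs_add_le _ _).trans (add_le_add (abs_add_le _ _) le_rfl)) ?_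
    rw [abs_sub_comm (round x : ℝ) x]
    linarith
  rw [← Int.cast_abs] at h3
  have h4 : |round x - round y| ≤ (1 : ℤ) := by
    have h' : |round x - round y| < (2 : ℤ) := by exact_mod_cast h3
    obtain ⟨h5, h6⟩ := abs_lt.mp h'
    exact abs_le.mpr ⟨by omega, by omega⟩
  have h5 : ((|round x - round y| : ℤ) : ℝ) ≤ 1 := by exact_mod_cast h4
  rw [Int.cast_abs] at h5; push_cast at h5; exact h5

/-- Nearest-lattice rounding moves a coordinate by at most half the mesh: `|x − round(Tx)/T| ≤ 1/(2T)`. -/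
theorem abs_sub_round_div_le {T : ℝ} (hT : 0 < T) (x : ℝ) : |x - round (T * x) / T| ≤ 1 / (2 * T) := by
  have h := abs_sub_round (T * x)
  have e : x - round (T * x) / T = (T * x - round (T * x)) / T := by field_simp
  rw [e, abs_div, abs_of_pos hT, div_le_div_iff₀ hT (by linarith)]
  nlinarith [abs_nonneg (T * x - round (T * x))]

/-- Rounding a non-negative number to the lattice gives a non-negative number. -/
theorem round_div_nonneg {T x : ℝ} (hT : 0 < T) (hx : 0 ≤ x) : 0 ≤ (round (T * x) : ℝ) / T := by
  refine div_nonneg ?_ hT.le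
  have h : (0 : ℤ) ≤ round (T * x) := by
    rw [round_eq]
    exact Int.floor_nonneg.mpr (by positivity)
  exact_mod_cast h

/-! ### One lattice step -/

/-- The forms of a displaced direction: `h_k(aOfS s) = h_k(a) + φ_k(s − s(a))`. -/
theorem h28_aOfS_eq_add_phiForm (a : Dir) (s : Fin 8 → ℝ) (k : Fin 28) :
    h28 (aOfS s) k = h28 a k + phiForm (s - sParam a) k := by
  have e : s = sParam a + (s - sParam a) := by abel
  have h1 : h28 (aOfS s) k = phiForm s k := rfl
  have h2 : h28 a k = phiForm (sParam a) k := by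
    show h28 a k = h28 (aOfS (sParam a)) k; rw [aOfS_sParam]
  rw [h1, h2, ← phiForm_add, ← e]

/-- **ONE LATTICE STEP.** Let `r ∈ (1/T)ℤ⁸` (`T·r_j ∈ ℤ`, `T > 0`) be symmetric parameters of a direction of the closed
box all of whose 28 forms are `≥ 2/T`, and `η` a displacement of form size `Y(η) ≤ 1/T` with `aOfS (r + η)` in the
closed box. Then `|Φ(aOfS (r+η)) − Φ(aOfS r)| ≤ (28·log(T·x_max(aOfS r)+1) + 203)/T` (file (2)'s two-sided uniform
bound on the ball of radius `ρ = 1/T`, where `log(1/(Tρ)) = 0`; no-cancellation constants — a continuity statement,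
not a certificate). -/
theorem abs_phi30_step {T : ℝ} (hT : 0 < T) {r : Fin 8 → ℝ} (hlat : ∀ j : Fin 8, ∃ z : ℤ, T * r j = z)
    (hbox : BZBox (aOfS r)) (hforms : ∀ k, 2 / T ≤ h28 (aOfS r) k) (η : Fin 8 → ℝ)
    (hY : shiftSize η ≤ 1 / T) (hbox' : BZBox (aOfS (r + η))) :
    |phi30 (aOfS (r + η)) - phi30 (aOfS r)| ≤ (28 * Real.log (T * xMax (aOfS r) + 1) + 203) / T := by
  have h2T : 0 < 2 / T := div_pos two_pos hT
  have hpos : ∀ k, 0 < h28 (aOfS r) k := fun k => h2T.trans_le (hforms k)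
  have hlat' : ∀ j : Fin 8, ∃ z : ℤ, T * sParam (aOfS r) j = z := by rw [sParam_aOfS]; exact hlat
  have hper := hper_of_lattice hlat'
  have hρT : T * (1 / T) ≤ 1 := by rw [mul_one_div_cancel hT.ne']
  have hρx : 1 / T ≤ xMin (aOfS r) / 2 := by
    obtain ⟨k, -, hk⟩ := Finset.exists_mem_eq_inf' Finset.univ_nonempty (h28 (aOfS r))
    rw [xMin, hk]
    have := hforms k
    have e : 2 / T = 2 * (1 / T) := by ring
    linarith
  have hbox'' : BZBox (aOfS (sParam (aOfS r) + η)) := by rw [sParam_aOfS]; exact hbox'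
  have h := abs_phi30_sub_le_on_ball hbox hpos hT hper hρT hρx η hY hbox''
  rw [sParam_aOfS] at h
  have hlog : Real.log (1 / (T * (1 / T))) = 0 := by
    rw [mul_one_div_cancel hT.ne', div_one, Real.log_one]
  rw [hlog, mul_zero, zero_add] at h
  calc _ ≤ 1 / T * (28 * Real.log (T * xMax (aOfS r) + 1) + 203) := h
    _ = _ := by ring

/-! ### The eight-step walk between neighbouring lattice points -/

/-- **THE EIGHT-STEP WALK.** Let `p, q ∈ (1/T)ℤ⁸` with `|q_j − p_j| ≤ 1/T` for every `j`, and suppose every point `s`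
of their coordinate hull (`s_j ∈ {p_j, q_j}` for each `j`) gives a direction `aOfS s` of the closed box with all 28
forms `≥ 2/T` and `x_max(aOfS s) ≤ X`. Then `|Φ(aOfS q) − Φ(aOfS p)| ≤ 8·(28·log(T·X+1) + 203)/T`: walk from `p` to
`q` changing ONE symmetric parameter at a time — each step is a single-parameter displacement of form size `≤ 1/T`
(`shiftSize_le_of_single`), inside the range of `abs_phi30_step`, which a diagonal step (form size up to `2/T`) would
leave. (A continuity statement with no-cancellation constants; nothing certified.) -/
theorem abs_phi30_sub_le_of_walk {T X : ℝ} (hT : 0 < T) {p q : Fin 8 → ℝ}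
    (hp : ∀ j : Fin 8, ∃ z : ℤ, T * p j = z) (hq : ∀ j : Fin 8, ∃ z : ℤ, T * q j = z)
    (hstep : ∀ j, |q j - p j| ≤ 1 / T)
    (hhull : ∀ s : Fin 8 → ℝ, (∀ j, s j = p j ∨ s j = q j) →
      BZBox (aOfS s) ∧ (∀ k, 2 / T ≤ h28 (aOfS s) k) ∧ xMax (aOfS s) ≤ X) :
    |phi30 (aOfS q) - phi30 (aOfS p)| ≤ 8 * ((28 * Real.log (T * X + 1) + 203) / T) := by
  obtain ⟨r, hr⟩ : ∃ r : ℕ → (Fin 8 → ℝ), r = fun n j => if j.val < n then q j else p j := ⟨_, rfl⟩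
  have hrhull : ∀ n j, r n j = p j ∨ r n j = q j := by
    intro n j
    by_cases h : j.val < n
    · right; simp [hr, h]
    · left; simp [hr, h]
  have hrlat : ∀ n j, ∃ z : ℤ, T * r n j = z := by
    intro n j
    rcases hrhull n j with h | h <;> rw [h]
    exacts [hp j, hq j]
  obtain ⟨c, hc⟩ : ∃ c : ℝ, c = (28 * Real.log (T * X + 1) + 203) / T := ⟨_, rfl⟩
  -- one step of the walk
  have hstep1 : ∀ n, n < 8 → |phi30 (aOfS (r (n + 1))) - phi30 (aOfS (r n))| ≤ c := by
    intro n hn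
    obtain ⟨i, hi⟩ : ∃ i : Fin 8, i = ⟨n, hn⟩ := ⟨_, rfl⟩
    obtain ⟨η, hη⟩ : ∃ η : Fin 8 → ℝ, η = fun j => if j = i then q j - p j else 0 := ⟨_, rfl⟩
    have hival : i.val = n := by rw [hi]
    have hsupp : ∀ j, j ≠ i → η j = 0 := fun j hj => by simp [hη, hj]
    have hηi : η i = q i - p i := by simp [hη]
    have hnext : r (n + 1) = r n + η := by
      funext j
      simp only [hr, hη, Pi.add_apply]
      by_cases h1 : j.val < n
      · have hji : j ≠ i := fun e => by rw [e, hival] at h1; exact lt_irrefl _ h1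
        have h2 : j.val < n + 1 := by omega
        rw [if_pos h2, if_pos h1, if_neg hji, add_zero]
      · by_cases hji : j = i
        · have h2 : j.val < n + 1 := by rw [hji, hival]; omega
          rw [if_pos h2, if_neg h1, if_pos hji]; ring
        · have hne : j.val ≠ n := fun e => hji (Fin.ext (by rw [e, ← hival]))
          have h2 : ¬ j.val < n + 1 := by omega
          rw [if_neg h2, if_neg h1, if_neg hji, add_zero]
    obtain ⟨hboxn, hformsn, hXn⟩ := hhull (r n) (hrhull n)
    obtain ⟨hboxn1, hformsn1, -⟩ := hhull (r (n + 1)) (hrhull (n + 1))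
    have hY : shiftSize η ≤ 1 / T := by
      refine (shiftSize_le_of_single hsupp).trans ?_
      rw [hηi]; exact hstep i
    have h := abs_phi30_step hT (hrlat n) hboxn hformsn η hY (by rw [← hnext]; exact hboxn1)
    rw [← hnext] at h
    refine h.trans ?_
    rw [hc]
    refine div_le_div_of_nonneg_right ?_ hT.le
    have hx0 : 0 < T * xMax (aOfS (r n)) + 1 := by
      have := (div_pos two_pos hT).trans_le ((hformsn 0).trans (le_xMax _ 0))
      nlinarith
    have := Real.log_le_log hx0 (by nlinarith : T * xMax (aOfS (r n)) + 1 ≤ T * X + 1)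
    linarith
  -- the walk by induction
  have hwalk : ∀ n, n ≤ 8 → |phi30 (aOfS (r n)) - phi30 (aOfS p)| ≤ n * c := by
    intro n
    induction n with
    | zero =>
      intro _
      have h0 : r 0 = p := by funext j; simp [hr]
      rw [h0]; simp
    | succ n ih =>
      intro hn
      have h1 := hstep1 n (by omega)
      have h2 := ih (by omega)
      have e : phi30 (aOfS (r (n + 1))) - phi30 (aOfS p)
          = (phi30 (aOfS (r (n + 1))) - phi30 (aOfS (r n))) + (phi30 (aOfS (r n)) - phi30 (aOfS p)) := by ring
      rw [e]
      refine (abs_add_le _ _).trans ?_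
      have ec : ((n + 1 : ℕ) : ℝ) * c = (n : ℝ) * c + c := by push_cast; ring
      rw [ec]
      linarith
  have h8 : r 8 = q := by funext j; simp [hr, j.isLt]
  have := hwalk 8 le_rfl; rw [h8, hc] at this; exact_mod_cast this

/-! ### `Φ` is locally log-Lipschitz on the box -/

/-- The margins `s₀ − s_j` are forms: if all 28 forms of `a` are `≥ μ` then `μ ≤ s₀(a) − s_{j+1}(a)`. -/
theorem le_sParam_zero_sub_of_forms {a : Dir} {μ : ℝ} (hμ : ∀ k, μ ≤ h28 a k) (j : Fin 7) :
    μ ≤ sParam a 0 - sParam a j.succ := by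
  have e : h28 a = h28 (aOfS (sParam a)) := by rw [aOfS_sParam]
  have h := fun k => e ▸ hμ k
  simp only [h28_aOfS] at h
  fin_cases j
  · simpa using h 14
  · simpa using h 1
  · simpa using h 3
  · simpa using h 11
  · simpa using h 12
  · simpa using h 16
  · simpa using h 23

/-- **`Φ` IS LOCALLY LOG-LIPSCHITZ ON THE CLOSED BOX.** Let `a, a′` be directions of the closed box, all 28 forms of `a`
at least `μ`, and `‖s(a′) − s(a)‖ ≤ D` (sup norm of the symmetric parameters) with `0 < D ≤ μ/8`. Then
**`|Φ(a′) − Φ(a)| ≤ D·(560·log(x_max(a)/(2D) + 3) + 4060)`** — an explicit `x·log(1/x)` modulus of continuity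
between ANY two directions, rational or not (round both to the lattice of mesh `2D`, one step of form size `≤ 2D`
each, and walk between the two roundings in eight single-parameter steps; `T = 1/(2D)`, ten steps of
`abs_phi30_step`'s size, every hull point having forms `≥ μ − 4D ≥ 4D = 2/T` and `x_max ≤ x_max(a) + 4D`). With P2
g19's `phi30_diffQuot_tendsto_cuspSlope` the order `x·log(1/x)` is attained wherever a cusp slope is non-zero, so it
is the exact local modulus of continuity of the MODEL saving. HONEST: absolute constants of the no-cancellation scale;
a continuity theorem — NOT a usable bound, nothing certified; nothing about `γ`, S-E's constant (S-E / S-E′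
CONJECTURED), C2 (OPEN) or `ζ(5)`. -/
theorem abs_phi30_sub_le_of_norm_le {a a' : Dir} (ha : BZBox a) (ha' : BZBox a') {μ D : ℝ}
    (hμ : ∀ k, μ ≤ h28 a k) (hD : 0 < D) (hDμ : 8 * D ≤ μ) (hdist : ‖sParam a' - sParam a‖ ≤ D) :
    |phi30 a' - phi30 a| ≤ D * (560 * Real.log (xMax a / (2 * D) + 3) + 4060) := by
  -- the mesh `T = 1/(2D)`
  obtain ⟨T, hTdef⟩ : ∃ T : ℝ, T = 1 / (2 * D) := ⟨_, rfl⟩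
  have hT : 0 < T := by rw [hTdef]; positivity
  have h1T : 1 / T = 2 * D := by rw [hTdef, one_div_one_div]
  have h2T : 1 / (2 * T) = D := by rw [hTdef]; field_simp
  have hTD : T * D = 1 / 2 := by rw [hTdef]; field_simp
  -- the two roundings
  obtain ⟨p, hp⟩ : ∃ p : Fin 8 → ℝ, ∀ j, p j = round (T * sParam a j) / T := ⟨fun j => _, fun j => rfl⟩
  obtain ⟨q, hq⟩ : ∃ q : Fin 8 → ℝ, ∀ j, q j = round (T * sParam a' j) / T := ⟨fun j => _, fun j => rfl⟩
  have hplat : ∀ j, ∃ z : ℤ, T * p j = z := fun j =>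
    ⟨round (T * sParam a j), by rw [hp j, mul_div_cancel₀ _ hT.ne']⟩
  have hqlat : ∀ j, ∃ z : ℤ, T * q j = z := fun j =>
    ⟨round (T * sParam a' j), by rw [hq j, mul_div_cancel₀ _ hT.ne']⟩
  have hpa : ∀ j, |sParam a j - p j| ≤ D := fun j => by
    rw [hp j, ← h2T]; exact abs_sub_round_div_le hT _
  have hqa' : ∀ j, |sParam a' j - q j| ≤ D := fun j => by
    rw [hq j, ← h2T]; exact abs_sub_round_div_le hT _
  have haa' : ∀ j, |sParam a' j - sParam a j| ≤ D := fun j =>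
    (by simpa using norm_le_pi_norm (sParam a' - sParam a) j : |sParam a' j - sParam a j| ≤ ‖sParam a' - sParam a‖)
      |>.trans hdist
  have hqa : ∀ j, |q j - sParam a j| ≤ 2 * D := fun j => by
    have h1 := hqa' j; have h2 := haa' j
    rw [abs_sub_comm] at h1
    calc |q j - sParam a j| = |(q j - sParam a' j) + (sParam a' j - sParam a j)| := by ring_nf
      _ ≤ |q j - sParam a' j| + |sParam a' j - sParam a j| := abs_add_le _ _
      _ ≤ 2 * D := by linarith
  -- neighbouring lattice points
  have hstep : ∀ j, |q j - p j| ≤ 1 / T := by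
    intro j
    have h : |T * sParam a' j - T * sParam a j| ≤ 1 / 2 := by
      rw [← mul_sub, abs_mul, abs_of_pos hT, ← hTD]
      exact mul_le_mul_of_nonneg_left (haa' j) hT.le
    have h1 := abs_round_sub_round_le_one h
    rw [hq j, hp j, ← sub_div, abs_div, abs_of_pos hT, div_le_div_iff₀ hT hT]
    nlinarith
  -- the hull facts: every point with coordinates from `p` or `q` is within `2D` of `s(a)` coordinatewise
  have hs0 : μ ≤ sParam a 0 := by
    have h := le_sParam_zero_sub_of_forms hμ 0
    have := (ha.2 0).1
    simp only [Fin.succ_zero_eq_one] at h this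
    linarith
  have hhull : ∀ s : Fin 8 → ℝ, (∀ j, s j = p j ∨ s j = q j) →
      BZBox (aOfS s) ∧ (∀ k, 2 / T ≤ h28 (aOfS s) k) ∧ xMax (aOfS s) ≤ xMax a + 4 * D := by
    intro s hs
    have hclose : ∀ j, |s j - sParam a j| ≤ 2 * D := by
      intro j
      rcases hs j with h | h <;> rw [h]
      · have := hpa j; rw [abs_sub_comm] at this; linarith
      · exact hqa j
    have hnorm : ‖s - sParam a‖ ≤ 2 * D :=
      (pi_norm_le_iff_of_nonneg (by linarith)).mpr fun j => by
        rw [Real.norm_eq_abs]; exact hclose j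
    have hforms : ∀ k, |h28 (aOfS s) k - h28 a k| ≤ 4 * D := by
      intro k
      rw [h28_aOfS_eq_add_phiForm a s k, add_sub_cancel_left]
      exact (abs_phiForm_le_two_mul_norm _ k).trans (by linarith)
    have hnonneg : ∀ j, 0 ≤ s j := by
      intro j
      rcases hs j with h | h <;> rw [h]
      · rw [hp j]; exact round_div_nonneg hT (Fin.cases ha.1.le (fun i => (ha.2 i).1) j)
      · rw [hq j]; exact round_div_nonneg hT (Fin.cases ha'.1.le (fun i => (ha'.2 i).1) j)
    refine ⟨?_, fun k => ?_, ?_⟩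
    · -- box membership
      unfold BZBox
      rw [sParam_aOfS]
      have h0 := abs_le.mp (hclose 0)
      refine ⟨by linarith [h0.1], fun j => ⟨hnonneg j.succ, ?_⟩⟩
      have hj := abs_le.mp (hclose j.succ)
      have hm := le_sParam_zero_sub_of_forms hμ j
      linarith [hj.2, h0.1]
    · have h := abs_le.mp (hforms k)
      have := hμ k
      rw [show 2 / T = 2 * (1 / T) by ring, h1T]
      linarith [h.1]
    · refine Finset.sup'_le _ _ fun k _ => ?_
      have h := abs_le.mp (hforms k)
      linarith [h.2, le_xMax a k]
  have hX : T * (xMax a + 4 * D) + 1 = xMax a / (2 * D) + 3 := by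
    rw [hTdef]; field_simp; ring
  obtain ⟨c, hc⟩ : ∃ c : ℝ, c = (28 * Real.log (T * (xMax a + 4 * D) + 1) + 203) / T := ⟨_, rfl⟩
  have hxpos : ∀ s : Fin 8 → ℝ, (∀ j, s j = p j ∨ s j = q j) → 0 < T * xMax (aOfS s) + 1 := by
    intro s hs
    obtain ⟨-, hf, -⟩ := hhull s hs
    have := (div_pos two_pos hT).trans_le ((hf 0).trans (le_xMax _ 0))
    nlinarith
  have hcmono : ∀ s : Fin 8 → ℝ, (∀ j, s j = p j ∨ s j = q j) →
      (28 * Real.log (T * xMax (aOfS s) + 1) + 203) / T ≤ c := by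
    intro s hs
    obtain ⟨-, -, hXs⟩ := hhull s hs
    rw [hc]
    refine div_le_div_of_nonneg_right ?_ hT.le
    have := Real.log_le_log (hxpos s hs) (by nlinarith : T * xMax (aOfS s) + 1 ≤ T * (xMax a + 4 * D) + 1)
    linarith
  have hpP : ∀ j, p j = p j ∨ p j = q j := fun j => Or.inl rfl
  have hqQ : ∀ j, q j = p j ∨ q j = q j := fun j => Or.inr rfl
  -- legs 1 and 3: `a`, `a′` to their roundings `p`, `q`; leg 2: the walk
  have hleg1 : |phi30 a - phi30 (aOfS p)| ≤ c := by
    obtain ⟨hb, hf, -⟩ := hhull p hpP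
    have hY : shiftSize (sParam a - p) ≤ 1 / T := by
      refine (shiftSize_le_two_mul_norm _).trans ?_
      have hn : ‖sParam a - p‖ ≤ D :=
        (pi_norm_le_iff_of_nonneg hD.le).mpr fun j => by rw [Real.norm_eq_abs]; exact hpa j
      rw [h1T]; linarith
    have h := abs_phi30_step hT hplat hb hf (sParam a - p) hY (by rw [add_sub_cancel, aOfS_sParam]; exact ha)
    rw [add_sub_cancel, aOfS_sParam] at h
    exact h.trans (hcmono p hpP)
  have hleg3 : |phi30 a' - phi30 (aOfS q)| ≤ c := by
    obtain ⟨hb, hf, -⟩ := hhull q hqQ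
    have hY : shiftSize (sParam a' - q) ≤ 1 / T := by
      refine (shiftSize_le_two_mul_norm _).trans ?_
      have hn : ‖sParam a' - q‖ ≤ D :=
        (pi_norm_le_iff_of_nonneg hD.le).mpr fun j => by rw [Real.norm_eq_abs]; exact hqa' j
      rw [h1T]; linarith
    have h := abs_phi30_step hT hqlat hb hf (sParam a' - q) hY (by rw [add_sub_cancel, aOfS_sParam]; exact ha')
    rw [add_sub_cancel, aOfS_sParam] at h
    exact h.trans (hcmono q hqQ)
  have hleg2 : |phi30 (aOfS q) - phi30 (aOfS p)| ≤ 8 * c := by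
    rw [hc]; exact abs_phi30_sub_le_of_walk hT hplat hqlat hstep hhull
  have hcval : c = 2 * D * (28 * Real.log (xMax a / (2 * D) + 3) + 203) := by
    rw [hc, hX, div_eq_mul_one_div, h1T]; ring
  have e : phi30 a' - phi30 a
      = (phi30 a' - phi30 (aOfS q)) + (phi30 (aOfS q) - phi30 (aOfS p)) - (phi30 a - phi30 (aOfS p)) := by ring
  rw [e]
  refine (abs_sub _ _).trans ((add_le_add ((abs_add_le _ _).trans (add_le_add hleg3 hleg2)) hleg1).trans ?_)
  have htot : c + 8 * c + c = D * (560 * Real.log (xMax a / (2 * D) + 3) + 4060) := by rw [hcval]; ring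
  exact htot.le

end Summit.KontsevichZagierPeriods.Zeta5Search.Barrier.ConeGamma

end
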